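import Literature.Topology.FourManifolds.SurfaceGroupNielsenCoreSides
import Literature.Topology.FourManifolds.SurfaceGroupNielsenCoreSeparation2
import Literature.Topology.FourManifolds.SurfaceGroupNielsenCoreNoDoublePoint
import Literature.GroupTheory.CombinatorialGroupTheory.BinaryProductParity
import Literature.GroupTheory.CombinatorialGroupTheory.ReflectionClosedIndexSets
import HarnessLib

/-!
# Nielsen's theorem, pillar CORE: a double point at the two portals of one symbol

Topic `Literature/Topology/FourManifolds`.  The case of the case analysis of a double point
`a < b` on the closed path of a potential-minimal configuration (Zieschang–Vogt–Coldewey, LNM 835,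
proof of Thm. 5.3.2 with Lemma 5.3.4, in the lead's minimal-counterexample recasting) in which
both cuts are portals and the two portal occurrences are the two letters `k`, `k̄` of ONE symbol:
`a` cuts the kernel of `k` between the slots `sa - 1 | sa` of its value `V` (`|V| = n`) and `b`
cuts the kernel of `k̄` between the slots `sb - 1 | sb` of `V̄ = V⁻¹`.

* **Mirrored cuts** (`sa + sb = n`: the visit at `b` sits in `k̄` at the mirror image of the
  visit at `a`): the translation carrying the path of `k` to the reversed path of `k̄` fixes the
  double point, so `E_{k̄} = E_{k+1}` and the block of occurrences `k, …, k̄` (symbol-closed by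
  Claim (A)) has trivial value — a decomposition, contradiction (`false_of_occStart_eq`).
* **Non-mirrored cuts**: the crossing edges of the fixation are exactly the formal edges at the
  slots `q` of `k` in the crossing set `{q < n | q < sa ↔ n - 1 - q < sb}`; the parity principle
  (no lone crossing edge at a level) makes it closed under `q ↦ n - 1 - q` without fixed points,
  so (`crossSet_structure`) `sa = sb`, `n` is even and the set is `[n - sa, sa)` (case I) or
  `[sa, n - sa)` (case II); (P2) forbids both ends of a crossing edge to be kernel slots and two
  heads (two tails) are never formal partners, so in case I exactly one end of each crossing edge
  is a head slot, in case II exactly one is a tail slot, which forces both occurrences to be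
  cancelled by exactly half from the same side (`crossSet_caseI_halves`,
  `crossSet_caseII_halves`) — excluded at a potential minimum (`not_both_first_halves`,
  `not_both_second_halves`).

## References

* H. Zieschang, E. Vogt, H.-D. Coldewey, *Surfaces and Planar Discontinuous Groups*, LNM 835
  (1980), proof of Thm. 5.3.2 and Lemma 5.3.4. [ZieschangVogtColdewey1980]
-/

noncomputable section

namespace Literature.Topology.FourManifolds

open Literature.GroupTheory.CombinatorialGroupTheory Literature.GroupTheory.CombinatorialGroupTheory.CycFactors
open List

namespace SurfaceGroup

namespace Config

variable {g : ℕ} {φ : surfaceGen g → SurfaceGroup g}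

/-- Prefixes of `V⁻¹` are inverses of suffixes of `V` — a duplicate of
`SurfaceGroup.take_invRev` (`SurfaceGroupCayleyCounting`), kept as a deprecated alias. [folklore] -/
@[deprecated SurfaceGroup.take_invRev (since := "2026-08-17")]
alias pps_take_invRev := SurfaceGroup.take_invRev

section PPSame

variable (hg : 2 ≤ g) (hI : Indecomposable φ) (hM : MarkedNontrivial φ) (κ : Config φ) (hmin : κ.IsMin)
  (d : κ.DoublePoint)
include hg hI hM hmin

/-- **No double point at the two portals of one symbol.**
[cite: ZieschangVogtColdewey1980, proof of Thm. 5.3.2 and Lemma 5.3.4] -/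
theorem false_of_doublePoint_PP_same {k : ℕ} (hPa : κ.PortalAt d.a k)
    (hPb : κ.PortalAt d.b (κ.bar k)) : False := by
  have hg1 : 1 ≤ g := by omega
  have hN := κ.cycNielsen_U hg1 hI hM hmin
  have hU := κ.U_ne_nil hg1
  have hbar := κ.isPairing_bar
  have hab := d.lt
  have hbℓ := d.lt_length
  have hm : κ.w.length = 4 * g := κ.length_w
  have hk : k < κ.w.length := κ.lt_length_of_portalAt hPa (hab.trans hbℓ).le
  have hkU : k < κ.U.length := by rw [length_U]; exact hk
  have hbkU : κ.bar k < κ.U.length := hbar.lt k hkU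
  have hbk : κ.bar k < κ.w.length := by rw [← length_U]; exact hbkU
  have hbne : κ.bar k ≠ k := hbar.bar_ne k hkU
  have hbb : κ.bar (κ.bar k) = k := hbar.bar_bar k hkU
  -- numerical data of `k` and `k̄`
  set n := (fac κ.U k).length with hn
  have hnbar : (fac κ.U (κ.bar k)).length = n := hbar.length_fac_bar hkU
  have hVbar : fac κ.U (κ.bar k) = FreeGroup.invRev (fac κ.U k) := hbar.fac_bar k hkU
  set c₁ := jc κ.U (cpred κ.U k) with hc₁
  set c₂ := jc κ.U k with hc₂
  set e₁ := jc κ.U (cpred κ.U (κ.bar k)) with he₁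
  set e₂ := jc κ.U (κ.bar k) with he₂
  have hcc : c₁ + c₂ < n := hN.jc_add_jc_lt hU k
  have hee : e₁ + e₂ < n := by have := hN.jc_add_jc_lt hU (κ.bar k); rwa [hnbar] at this
  have h2c₂ : 2 * c₂ ≤ n := (hN.pair k).1
  have h2e₂ : 2 * e₂ ≤ n := by have := (hN.pair (κ.bar k)).1; rwa [hnbar] at this
  have h2c₁ : 2 * c₁ ≤ n := by
    have h := (hN.pair (cpred κ.U k)).2
    have e : cpred κ.U k + 1 = k + κ.U.length := by unfold cpred; omega
    rwa [e, fac_add_length] at h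
  have h2e₁ : 2 * e₁ ≤ n := by
    have h := (hN.pair (cpred κ.U (κ.bar k))).2
    have e : cpred κ.U (κ.bar k) + 1 = κ.bar k + κ.U.length := by unfold cpred; omega
    rwa [e, fac_add_length, hnbar] at h
  have hKend : κ.Kend k = κ.Kstart k + (n - c₁ - c₂) := by
    rw [Kend, length_kernel _ _ hcc.le]
  have hKend' : κ.Kend (κ.bar k) = κ.Kstart (κ.bar k) + (n - e₁ - e₂) := by
    rw [Kend, length_kernel _ _ (by rw [hnbar]; exact hee.le), hnbar]
  set sa := κ.slotAt k d.a with hsa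
  set sb := κ.slotAt (κ.bar k) d.b with hsb
  have hsa' : sa = d.a - κ.Kstart k + c₁ := rfl
  have hsb' : sb = d.b - κ.Kstart (κ.bar k) + e₁ := rfl
  have ha1 := hPa.1; have ha2 := hPa.2; have hb1 := hPb.1; have hb2 := hPb.2
  have hc₁sa : c₁ < sa := by omega
  have hsan : sa < n - c₂ := by omega
  have he₁sb : e₁ < sb := by omega
  have hsbn : sb < n - e₂ := by omega
  -- the two portal occurrences are different: `hsep`; and `k < k̄`
  have hsep : ∀ j, ¬ (κ.PortalAt d.a j ∧ κ.PortalAt d.b j) := by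
    rintro j ⟨h1, h2⟩
    exact hbne ((κ.portalAt_unique h2 hPb).symm.trans (κ.portalAt_unique h1 hPa))
  have hklt : k < κ.bar k := by
    rcases lt_trichotomy k (κ.bar k) with h | h | h
    · exact h
    · exact absurd h.symm hbne
    · have := κ.Kend_le_Kstart_of_lt h
      omega
  have hP2 := DoublePoint.kpos_mem_iff_of_chainEnd κ hg1 hI hM hmin d
  -- the vertex identity `E_{k̄} = E_{k+1}` holds iff the cuts are mirrored; start with the
  -- vertices at the two cuts
  have hva : κ.absv d.a = κ.occStart k * proj g (FreeGroup.mk ((fac κ.U k).take sa)) := by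
    have e : kpos κ.U (k, sa) = d.a := κ.kpos_slotAt ha1.le
    rw [← e]
    exact κ.absv_kpos hN hk (by omega) (by omega)
  have hvb : κ.absv d.b =
      κ.occStart (κ.bar k) * proj g (FreeGroup.mk ((fac κ.U (κ.bar k)).take sb)) := by
    have e : kpos κ.U (κ.bar k, sb) = d.b := κ.kpos_slotAt hb1.le
    rw [← e]
    exact κ.absv_kpos hN hbk (by omega) (by omega)
  have hvab : κ.absv d.a = κ.absv d.b := (κ.absv_eq_absv_iff _ _).2 d.pv_eq
  by_cases hmir : sa + sb = n
  · /- MIRRORED: `E_{k̄} = E_{k+1}`, and the block `k, …, k̄` is trivial and symbol-closed -/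
    have htake : (fac κ.U (κ.bar k)).take sb = FreeGroup.invRev ((fac κ.U k).drop sa) := by
      rw [hVbar, take_invRev]
      congr 2
      omega
    have hocc : κ.occStart (κ.bar k) = κ.occStart (k + 1) := by
      have e1 : κ.occStart (κ.bar k) =
          κ.absv d.b * (proj g (FreeGroup.mk ((fac κ.U (κ.bar k)).take sb)))⁻¹ := by
        rw [hvb, mul_inv_cancel_right]
      rw [e1, ← hvab, hva, htake, ← FreeGroup.inv_mk, map_inv, inv_inv, mul_assoc, ← map_mul,
        FreeGroup.mul_mk, List.take_append_drop, κ.occStart_mul_proj_fac hk]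
    have hocc' : κ.occStart k = κ.occStart (κ.bar k + 1) := by
      rw [← κ.occStart_mul_proj_fac hbk, hocc, ← κ.occStart_mul_proj_fac hk, hVbar,
        ← FreeGroup.inv_mk, map_inv, mul_inv_cancel_right]
    -- Claim (A): the occurrences strictly between `k` and `k̄` are closed under `bar`
    have hbetween : ∀ j, j < κ.w.length → k < j → j < κ.bar k →
        k < κ.bar j ∧ κ.bar j < κ.bar k := by
      intro j hj h1 h2
      have hjU : j < κ.U.length := by rw [length_U]; exact hj
      have hin : κ.Inside d.a d.b j := by
        have := κ.Kend_le_Kstart_of_lt h1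
        have := κ.Kend_le_Kstart_of_lt h2
        exact ⟨by omega, by omega⟩
      have hjk : j ≠ k := by omega
      have hjb : j ≠ κ.bar k := by omega
      have hna : ¬ κ.PortalAt d.a j := fun h => hjk (κ.portalAt_unique h hPa)
      have hnb : ¬ κ.PortalAt d.b j := fun h => hjb (κ.portalAt_unique h hPb)
      have hna' : ¬ κ.PortalAt d.a (κ.bar j) := fun h =>
        hjb (by rw [← hbar.bar_bar j hjU, κ.portalAt_unique h hPa])
      have hnb' : ¬ κ.PortalAt d.b (κ.bar j) := fun h =>
        hjk (by rw [← hbar.bar_bar j hjU, κ.portalAt_unique h hPb, hbb])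
      have hin' := (κ.inside_iff_inside_bar hg1 hI hM hmin hP2 hj hna hnb hna' hnb').1 hin
      obtain ⟨h3, h4⟩ := hin'
      have hbj : κ.bar j < κ.w.length := by rw [← length_U]; exact hbar.lt j hjU
      constructor
      · by_contra hle
        have := κ.Kstart_mono (show κ.bar j ≤ k by omega)
        omega
      · by_contra hle
        have := κ.Kend_le_Kend (show κ.bar k ≤ κ.bar j by omega)
        omega
    by_cases hwrap : k = 0 ∧ κ.bar k + 1 = κ.w.length
    · -- the inside block `1, …, m - 2` (its complement `{0, m - 1}` is one symbol)
      obtain ⟨rfl, hlast⟩ := hwrap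
      refine false_of_occStart_eq hI κ (j₁ := 1) (j₂ := κ.bar 0) (by omega) (by omega) (by omega)
        (κ.blockClosed_of_bar fun j hj h1 h2 => ?_) (by rw [← hocc])
      have hjU : j < κ.U.length := by rw [length_U]; exact hj
      have hbj : κ.bar j < κ.w.length := by rw [← length_U]; exact hbar.lt j hjU
      constructor
      · by_contra h0
        have h0' : κ.bar j = 0 := by omega
        have := hbar.bar_bar j hjU
        rw [h0'] at this
        omega
      · by_contra h0
        have h0' : κ.bar j = κ.bar 0 := by omega
        have := hbar.bar_bar j hjU
        rw [h0', hbb] at this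
        omega
    · -- the block `k, …, k̄`
      refine false_of_occStart_eq hI κ (j₁ := k) (j₂ := κ.bar k + 1) (by omega) (by omega)
        (by omega) (κ.blockClosed_of_bar fun j hj h1 h2 => ?_) hocc'
      rcases Nat.lt_or_ge k j with hkj | hkj
      · rcases Nat.lt_or_ge j (κ.bar k) with hjb | hjb
        · have := hbetween j hj hkj hjb
          omega
        · obtain rfl : j = κ.bar k := by omega
          rw [hbb]; omega
      · obtain rfl : j = k := by omega
        omega
  · /- NON-MIRRORED: parity of crossing edges -/
    let s : ℕ × ℕ → Bool := fun σ => decide (κ.SideIn d.a d.b σ)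
    have hP2s : ∀ τ, IsKernelSlot κ.U τ → s τ = s (chainEnd κ.U κ.bar τ) := fun τ hτ =>
      κ.decide_sideIn_eq_decide_sideIn_chainEnd hg1 hI hM hmin hab hsep hP2 hτ
    have hJa : ¬ κ.IsJunction d.a := κ.not_isJunction_of_portalAt hPa
    have hJb : ¬ κ.IsJunction d.b := κ.not_isJunction_of_portalAt hPb
    -- crossing formal edges at the slots of `k`
    have hX : ∀ q, IsCrossing s (fedge κ.U κ.bar (k, q)) ↔ ¬ (sa ≤ q ↔ n - 1 - q < sb) := by
      intro q
      rw [isCrossing_fedge]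
      exact (κ.fcross_iff_decide_ne _ _ _).symm.trans
        (κ.fcross_iff_of_portalAt_left_of_portalAt_right_bar hsep hPa hPb q)
    -- every crossing edge is such an edge
    have hall : ∀ ε', IsEdge κ.U κ.bar ε' → IsCrossing s ε' →
        ∃ q, q < n ∧ ε' = fedge κ.U κ.bar (k, q) := by
      intro ε' hε' hc'
      obtain ⟨σ', hσ', h' | ⟨hkσ', h'⟩⟩ := hε'
      · subst h'
        have hfc : κ.FCross d.a d.b σ' :=
          (κ.fcross_iff_decide_ne _ _ _).2 (isCrossing_fedge.1 hc')
        have hσ'1 : σ'.1 < κ.w.length := by rw [← length_U]; exact hσ'.1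
        obtain ⟨j, q⟩ := σ'
        simp only at hσ'1
        by_cases h1 : j = k
        · subst h1
          exact ⟨q, hσ'.2, rfl⟩
        by_cases h2 : j = κ.bar k
        · subst h2
          have hq : q < n := by have h' : q < (fac κ.U (κ.bar k)).length := hσ'.2; rwa [hnbar] at h'
          refine ⟨n - 1 - q, by omega, ?_⟩
          rw [← fedge_fpartner hbar hσ']
          simp only [fpartner, hbb, hnbar]
        · exfalso
          have hjU : j < κ.U.length := hσ'.1
          refine κ.not_fcross_of_not_portalAt hg1 hI hM hmin hP2 hσ' ?_ ?_ ?_ ?_ hfc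
          · show ¬ κ.PortalAt d.a j
            exact fun h => h1 (κ.portalAt_unique h hPa)
          · show ¬ κ.PortalAt d.b j
            exact fun h => h2 (κ.portalAt_unique h hPb)
          · show ¬ κ.PortalAt d.a (κ.bar j)
            intro h
            have h3 : κ.bar j = k := κ.portalAt_unique h hPa
            exact h2 (by rw [← hbar.bar_bar j hjU, h3])
          · show ¬ κ.PortalAt d.b (κ.bar j)
            intro h
            have h3 : κ.bar j = κ.bar k := κ.portalAt_unique h hPb
            exact h1 (by rw [← hbar.bar_bar j hjU, h3, hbb])
      · subst h'
        exfalso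
        have hcc' : κ.CCross d.a d.b σ' :=
          (κ.ccross_iff_decide_ne hσ' hkσ').2 (isCrossing_cedge.1 hc')
        exact κ.not_ccross_of_not_isJunction hg1 hI hM hmin hab hbℓ hsep hJa hJb hσ' hcc'
    -- closure of the crossing set under reflection, no fixed point
    have hcl : ∀ q, q < n → ¬ (sa ≤ q ↔ n - 1 - q < sb) →
        ¬ (sa ≤ n - 1 - q ↔ n - 1 - (n - 1 - q) < sb) ∧ 2 * q + 1 ≠ n := by
      intro q hqn hq
      by_contra hnot
      have hσ : IsSlot κ.U (k, q) := ⟨hkU, hqn⟩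
      have hcross : IsCrossing s (fedge κ.U κ.bar (k, q)) := (hX q).2 hq
      refine false_of_crossing_alone_level hN hU hbar hP2s (isEdge_fedge hσ) hcross
        ⟨(k, q), mem_fedge.2 (Or.inl rfl), rfl⟩ fun ε' hε' hc' hlev => ?_
      obtain ⟨q', hq'n, rfl⟩ := hall ε' hε' hc'
      have hq' : ¬ (sa ≤ q' ↔ n - 1 - q' < sb) := (hX q').1 hc'
      have hl := hlev (k, q') (mem_fedge.2 (Or.inl rfl))
      simp only [level] at hl
      have hq'q : q' = q := by
        by_contra hne
        have h2 : q' = n - 1 - q := by omega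
        subst h2
        exact hnot ⟨hq', by omega⟩
      subst hq'q
      rfl
    -- no crossing edge joins two kernel slots
    have hkk : ∀ q, q < n → ¬ (sa ≤ q ↔ n - 1 - q < sb) →
        ¬ (IsKernelSlot κ.U (k, q) ∧ IsKernelSlot κ.U (κ.bar k, n - 1 - q)) := by
      rintro q hqn hq ⟨h1, h2⟩
      have hcross : IsCrossing s (fedge κ.U κ.bar (k, q)) := (hX q).2 hq
      exact false_of_isCrossing_kernel_pair hP2s h1 h2 (isCrossing_fedge.1 hcross)
    -- the structure of the crossing set
    have hmem : ∀ q, q ∈ crossSet n (sa - 1) (sb - 1) ↔ q < n ∧ ¬ (sa ≤ q ↔ n - 1 - q < sb) := by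
      intro q
      rw [mem_crossSet]
      constructor
      · rintro ⟨h1, h2⟩
        exact ⟨h1, by omega⟩
      · rintro ⟨h1, h2⟩
        exact ⟨h1, by omega⟩
    have hne : (crossSet n (sa - 1) (sb - 1)).Nonempty := by
      rcases Nat.lt_or_ge (sa + sb) n with h | h
      · exact ⟨sa, (hmem sa).2 ⟨by omega, by omega⟩⟩
      · exact ⟨sa - 1, (hmem (sa - 1)).2 ⟨by omega, by omega⟩⟩
    obtain ⟨hss, -, hcases⟩ := crossSet_structure (n := n) (p := sa - 1) (p' := sb - 1)
      (by omega) (by omega)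
      (fun q hq => by
        obtain ⟨h1, h2⟩ := (hmem q).1 hq
        exact (hmem _).2 ⟨by omega, (hcl q h1 h2).1⟩)
      (fun q hq => by
        obtain ⟨h1, h2⟩ := (hmem q).1 hq
        exact (hcl q h1 h2).2)
      hne
    have hsasb : sb = sa := by omega
    -- slots facts
    have hslotk : ∀ q, q < n → IsSlot κ.U (k, q) := fun q hq => ⟨hkU, hq⟩
    have hslotb : ∀ q, q < n → IsSlot κ.U (κ.bar k, q) := fun q hq =>
      ⟨hbkU, by show q < (fac κ.U (κ.bar k)).length; rw [hnbar]; exact hq⟩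
    rcases hcases with ⟨hI1, hS⟩ | ⟨hII1, hS⟩
    · /- case I: one head on each crossing edge -/
      refine κ.not_both_first_halves hI hM hmin hk ?_
      refine crossSet_caseI_halves (p := sa - 1) hI1 (fun q hq => ?_) h2c₁ (by simpa using h2e₁)
      rw [← hS] at hq
      obtain ⟨hqn, hqx⟩ := (hmem q).1 hq
      -- `(k, q)` and `(k̄, n-1-q)` are head or kernel slots, not both kernel, not both head
      have hq1 : q < sa := by rw [hS, Finset.mem_Ico] at hq; omega
      have hq2 : n - 1 - q < sb := by omega
      have hnk := hkk q hqn hqx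
      constructor
      · intro hh hh'
        -- two heads
        have h1 : IsHeadSlot κ.U (k, q) := ⟨hslotk q hqn, hh⟩
        have h2 : IsHeadSlot κ.U (κ.bar k, n - 1 - q) := ⟨hslotb _ (by omega), hh'⟩
        exact h1.not_isHeadSlot_fpartner hN hbar h2
      · intro hh'
        by_contra hh
        refine hnk ⟨⟨hslotk q hqn, by simp only; omega, by simp only; omega⟩,
          ⟨hslotb _ (by omega), by simp only; omega, by simp only [hnbar]; omega⟩⟩
    · /- case II: one tail on each crossing edge -/
      refine κ.not_both_second_halves hI hM hmin hk ?_
      refine crossSet_caseII_halves (p := sa - 1) hII1 (fun q hq => ?_) h2c₂ (by simpa using h2e₂)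
      rw [← hS] at hq
      obtain ⟨hqn, hqx⟩ := (hmem q).1 hq
      have hq1 : sa ≤ q := by rw [hS, Finset.mem_Ico] at hq; omega
      have hq2 : sb ≤ n - 1 - q := by omega
      have hnk := hkk q hqn hqx
      constructor
      · intro ht ht'
        have h1 : IsTailSlot κ.U (k, q) := ⟨hslotk q hqn, by simp only; omega⟩
        have h2 : IsTailSlot κ.U (κ.bar k, n - 1 - q) :=
          ⟨hslotb _ (by omega), by simp only [hnbar]; omega⟩
        exact h1.not_isTailSlot_fpartner hN hbar h2
      · intro ht'
        by_contra ht
        refine hnk ⟨⟨hslotk q hqn, by simp only; omega, by simp only; omega⟩,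
          ⟨hslotb _ (by omega), by simp only; omega, by simp only [hnbar]; omega⟩⟩

end PPSame

end Config

end SurfaceGroup

end Literature.Topology.FourManifolds

end
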